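import Summits.Ventures.PercRepro.C025ProfileGirthRowSuccPre

/-!
# THE ROW `(q, q+1)` OF THE PROFILE INEQUALITY AT GIRTH `≥ q + 1`, EVERY RANK (night-3 g18)

`C025ProfileGirthRowSucc` proves the row `(q, q+1)` when every `q`-subset is independent and `ρ(E) ≥ q + 3`: every
rank-`q` set `B` with `≥ q + 1` points has at least `m_B ≥ 3` points outside its closure, and `(q + m)/(q+1) + 1 ≤ m`.
Here the rank hypothesis is removed (`q ≥ 2`).  When `ρ(E) ≥ q + 2` one has only `m_B ≥ 2`, and a rank-`q` flat `F` with
exactly two points outside (`m = 2`) and `N = |F| ≥ 2q + 1` points overloads its `(q+1)`-subsets by `1/(q+1)` each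
(`(q+2)/(q+1) + 1 − 2`) while its `(q+2)`-subsets have slack `q/(q+1)` each (`2 − (q+2)/(q+1)`); since every `(q+1)`-subset
`C` of `F` has `N − q − 1 ≥ q` supersets `C ∪ {z} ⊆ F` of `q + 2` points and every `(q+2)`-subset has `q + 2` such subsets,
`q · #{overloaded} ≤ (q + 2) · #{slack} ≤ q² · #{slack}` for `q ≥ 2` — the double count of `C025ProfileGirthRowSuccPre`.
For `N ≤ 2q` the `(q+1)`-subsets have price `≤ 1` (`ρ(E ∖ C) ≤ |F ∖ C| + 2 ≤ q + 1`) and no overload.  The cases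
`ρ(E) < q + 1` (every price `0`) and `ρ(E) = q + 1` (complementation `B ↦ E ∖ B`) close the theorem.
* **`profileIneq_succ_of_girth`** `(hq : 2 ≤ q) (hg : ∀ T ⊆ M.E, T.encard ≤ q → M.Indep T) : ProfileIneq M q (q + 1)`;
* **`rls_succ_succ_of_girth`** — C-025 at `(q + 2, q)` at girth `≥ q + 1`, `q ≥ 2`; **`rls_of_girth_all`** — C-025 at
  `(p, q)` for every `p ≥ q + 2` at girth `≥ p − 1`, `q ≥ 2`.
No `def`, no `instance`, no notation.  Axioms: standard.
-/

open scoped Matroid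

namespace PercRepro

open Set Finset ThmH Staged

namespace GirthRows

variable {α : Type} [DecidableEq α] {M : Matroid α} [M.Finite]

open scoped Classical

/-- **Complementation**: if `ρ(E) = u` then the row `(q, u)` holds (`B ↦ E ∖ B` injects the demanding sets into the
level `u`; their price is `1`). -/
theorem profileIneq_of_eRank_eq {q u : ℕ} (h : M.eRank = u) : Profile.ProfileIneq M q u := by
  unfold Profile.ProfileIneq
  have hprice : ∀ B ∈ Profile.Rq M q, Profile.price M q u B =
      if M.eRk ((gr M \ B : Finset α) : Set α) = (u : ℕ∞) then (1 : ℚ) else 0 := by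
    intro B _
    unfold Profile.price
    have hle : M.eRk ((gr M \ B : Finset α) : Set α) ≤ (u : ℕ∞) := h ▸ M.eRk_le_eRank _
    by_cases heq : M.eRk ((gr M \ B : Finset α) : Set α) = (u : ℕ∞)
    · rw [if_pos heq, if_pos heq.symm.le, heq, ENat.toNat_coe, Nat.choose_symm_add, div_self]
      exact_mod_cast (Nat.choose_pos (by omega : q ≤ u + q)).ne'
    · rw [if_neg heq, if_neg]
      intro hu
      exact heq (le_antisymm hle hu)
  rw [Finset.sum_congr rfl hprice, Finset.sum_boole]
  have hinj : Set.InjOn (fun B : Finset α => gr M \ B)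
      ((Profile.Rq M q).filter (fun B => M.eRk ((gr M \ B : Finset α) : Set α) = (u : ℕ∞)) :
        Set (Finset α)) := by
    intro B hB B' hB' hBB'
    simp only at hBB'
    rw [Finset.mem_coe, Finset.mem_filter] at hB hB'
    have h1 := Finset.sdiff_sdiff_eq_self (Profile.mem_Rq.1 hB.1).1
    have h2 := Finset.sdiff_sdiff_eq_self (Profile.mem_Rq.1 hB'.1).1
    rw [← h1, ← h2, hBB']
  have hmaps : Set.MapsTo (fun B : Finset α => gr M \ B)
      ((Profile.Rq M q).filter (fun B => M.eRk ((gr M \ B : Finset α) : Set α) = (u : ℕ∞)) :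
        Set (Finset α)) (Shadow.levelSet M u : Set (Finset α)) := by
    intro B hB
    rw [Finset.mem_coe, Finset.mem_filter] at hB
    rw [Finset.mem_coe, Profile.mem_levelSet]
    exact ⟨Finset.sdiff_subset, hB.2⟩
  exact_mod_cast Finset.card_le_card_of_injOn _ hmaps hinj

/-- **THE ROW `(q, q+1)` AT GIRTH `≥ q + 1`, EVERY RANK**: if every set of at most `q` points is independent and
`q ≥ 2`, then `Profile.ProfileIneq M q (q + 1)`. -/
theorem profileIneq_succ_of_girth {q : ℕ} (hq : 2 ≤ q) (hg : ∀ T ⊆ M.E, T.encard ≤ q → M.Indep T) :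
    Profile.ProfileIneq M q (q + 1) := by
  classical
  rcases lt_or_ge M.eRank ((q + 1 : ℕ) : ℕ∞) with hlt | hge
  · exact profileIneq_of_eRank_lt hlt
  rcases lt_or_ge M.eRank ((q + 2 : ℕ) : ℕ∞) with hlt2 | hge2
  · -- ρ(E) = q + 1
    have heq : M.eRank = ((q + 1 : ℕ) : ℕ∞) := by
      have hfin : M.eRank ≠ ⊤ := ne_top_of_lt hlt2
      rw [← ENat.coe_toNat hfin] at hlt2 hge ⊢
      have a : q + 1 ≤ M.eRank.toNat := by exact_mod_cast hge
      have b : M.eRank.toNat < q + 2 := by exact_mod_cast hlt2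
      congr 1
      omega
    exact profileIneq_of_eRank_eq heq
  -- ρ(E) ≥ q + 2: the refined count with the transfer
  unfold Profile.ProfileIneq
  set n := (gr M).card with hn
  set Ra := (Profile.Rq M q).filter (fun B : Finset α => B.card = q) with hRa
  set Rb := (Profile.Rq M q).filter (fun B : Finset α => ¬ B.card = q) with hRb
  have hsplit : ∑ B ∈ Profile.Rq M q, Profile.price M q (q + 1) B =
      ∑ B ∈ Ra, Profile.price M q (q + 1) B + ∑ B ∈ Rb, Profile.price M q (q + 1) B := by
    rw [hRa, hRb]
    exact (Finset.sum_filter_add_sum_filter_not _ _ _).symm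
  have hRbmem : ∀ B ∈ Rb, B ∈ Profile.Rq M q ∧ q + 1 ≤ B.card := by
    intro B hB
    rw [hRb, Finset.mem_filter] at hB
    have h1 : rkN M B ≤ B.card := Staged.rkN_le_card B
    have h2 : rkN M B = q := Staged.rkN_eq_iff.2 (Profile.mem_Rq.1 hB.1).2
    exact ⟨hB.1, by omega⟩
  have hRbmem' : ∀ B ∈ Profile.Rq M q, q + 1 ≤ B.card → B ∈ Rb := by
    intro B hB hc
    rw [hRb, Finset.mem_filter]
    exact ⟨hB, by omega⟩
  have hRa_sub : Ra ⊆ Finset.powersetCard q (gr M) := by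
    intro B hB
    rw [hRa, Finset.mem_filter] at hB
    exact Finset.mem_powersetCard.2 ⟨(Profile.mem_Rq.1 hB.1).1, hB.2⟩
  have ha : ∑ B ∈ Ra, Profile.price M q (q + 1) B ≤ (Nat.choose n (q + 1) : ℚ) :=
    sum_price_le_choose_of_subset (by omega) hRa_sub
  -- the per-set bound with the transfer term
  have hb : ∑ B ∈ Rb, Profile.price M q (q + 1) B ≤
      ∑ B ∈ Rb, ((((gr M).filter (fun x => x ∉ M.closure (B : Set α))).card : ℚ) -
        (if B.card = q + 1 then (1 : ℚ) else 0) +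
        ((if B.card = q + 1 ∧ ((gr M).filter (fun x => x ∉ M.closure (B : Set α))).card = 2 ∧
            2 * q + 1 ≤ ((gr M).filter (fun x => x ∈ M.closure (B : Set α))).card then (1 : ℚ) / ((q : ℚ) + 1)
          else 0) +
        (if B.card = q + 2 ∧ ((gr M).filter (fun x => x ∉ M.closure (B : Set α))).card = 2 ∧
            2 * q + 1 ≤ ((gr M).filter (fun x => x ∈ M.closure (B : Set α))).card then -(q : ℚ) / ((q : ℚ) + 1)
          else 0))) := by
    apply Finset.sum_le_sum
    intro B hB
    obtain ⟨hBq, hBk⟩ := hRbmem B hB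
    have h2 := two_le_card_out hge2 (Profile.mem_Rq.1 hBq).2
    have := excess_le hq hBq hBk h2
    linarith
  -- the transfer sums to ≤ 0
  set A := Rb.filter (fun B : Finset α => B.card = q + 1 ∧
      ((gr M).filter (fun x => x ∉ M.closure (B : Set α))).card = 2 ∧
      2 * q + 1 ≤ ((gr M).filter (fun x => x ∈ M.closure (B : Set α))).card) with hAdef
  set Bf := Rb.filter (fun B : Finset α => B.card = q + 2 ∧
      ((gr M).filter (fun x => x ∉ M.closure (B : Set α))).card = 2 ∧
      2 * q + 1 ≤ ((gr M).filter (fun x => x ∈ M.closure (B : Set α))).card) with hBfdef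
  have htransfer : ∑ B ∈ Rb,
      ((if B.card = q + 1 ∧ ((gr M).filter (fun x => x ∉ M.closure (B : Set α))).card = 2 ∧
          2 * q + 1 ≤ ((gr M).filter (fun x => x ∈ M.closure (B : Set α))).card then (1 : ℚ) / ((q : ℚ) + 1)
        else 0) +
      (if B.card = q + 2 ∧ ((gr M).filter (fun x => x ∉ M.closure (B : Set α))).card = 2 ∧
          2 * q + 1 ≤ ((gr M).filter (fun x => x ∈ M.closure (B : Set α))).card then -(q : ℚ) / ((q : ℚ) + 1)
        else 0)) ≤ 0 := by
    rw [Finset.sum_add_distrib]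
    have e1 : ∑ B ∈ Rb, (if B.card = q + 1 ∧ ((gr M).filter (fun x => x ∉ M.closure (B : Set α))).card = 2 ∧
          2 * q + 1 ≤ ((gr M).filter (fun x => x ∈ M.closure (B : Set α))).card then (1 : ℚ) / ((q : ℚ) + 1)
        else 0) = (A.card : ℚ) * ((1 : ℚ) / ((q : ℚ) + 1)) := by
      rw [← Finset.sum_filter, Finset.sum_const, nsmul_eq_mul]
    have e2 : ∑ B ∈ Rb, (if B.card = q + 2 ∧ ((gr M).filter (fun x => x ∉ M.closure (B : Set α))).card = 2 ∧
          2 * q + 1 ≤ ((gr M).filter (fun x => x ∈ M.closure (B : Set α))).card then -(q : ℚ) / ((q : ℚ) + 1)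
        else 0) = (Bf.card : ℚ) * (-(q : ℚ) / ((q : ℚ) + 1)) := by
      rw [← Finset.sum_filter, Finset.sum_const, nsmul_eq_mul]
    rw [e1, e2]
    have hdc := card_cond_le_mul_card_cond' hq Rb hRbmem hRbmem'
    have hdc' : (A.card : ℚ) ≤ (q : ℚ) * (Bf.card : ℚ) := by
      rw [hAdef, hBfdef]
      exact_mod_cast hdc
    have key : (A.card : ℚ) * ((1 : ℚ) / ((q : ℚ) + 1)) + (Bf.card : ℚ) * (-(q : ℚ) / ((q : ℚ) + 1)) =
        ((A.card : ℚ) - (q : ℚ) * (Bf.card : ℚ)) / ((q : ℚ) + 1) := by ring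
    rw [key]
    apply div_nonpos_of_nonpos_of_nonneg
    · linarith
    · positivity
  -- the level: independent (q+1)-subsets and the sets B ∪ {y}
  set I := (Finset.powersetCard (q + 1) (gr M)).filter (fun S : Finset α => M.Indep (S : Set α)) with hI
  set D := (Finset.powersetCard (q + 1) (gr M)).filter (fun S : Finset α => ¬ M.Indep (S : Set α)) with hD
  have hID : I.card + D.card = Nat.choose n (q + 1) := by
    rw [hI, hD, Finset.card_filter_add_card_filter_not, Finset.card_powersetCard]
  set Rb1 := Rb.filter (fun B : Finset α => B.card = q + 1) with hRb1
  have hDRb1 : D = Rb1 := by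
    ext S
    rw [hD, hRb1, hRb, Finset.mem_filter, Finset.mem_filter, Finset.mem_filter, Finset.mem_powersetCard,
      Profile.mem_Rq]
    constructor
    · rintro ⟨⟨hSg, hSc⟩, hdep⟩
      have hr := rkN_eq_of_dep_of_girth hg hSg hSc hdep
      refine ⟨⟨⟨hSg, Staged.rkN_eq_iff.1 hr⟩, by omega⟩, hSc⟩
    · rintro ⟨⟨⟨hSg, hSr⟩, _⟩, hSc⟩
      refine ⟨⟨hSg, hSc⟩, ?_⟩
      intro hind
      have := hind.eRk_eq_encard
      rw [hSr, Set.encard_coe_eq_coe_finsetCard, hSc] at this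
      have : q = q + 1 := by exact_mod_cast this
      omega
  have hI_sub : I ⊆ Shadow.levelSet M (q + 1) := by
    intro S hS
    rw [hI, Finset.mem_filter, Finset.mem_powersetCard] at hS
    rw [Profile.mem_levelSet]
    refine ⟨hS.1.1, ?_⟩
    rw [hS.2.eRk_eq_encard, Set.encard_coe_eq_coe_finsetCard, hS.1.2]
  set J := Rb.biUnion (fun B => ((gr M).filter (fun x => x ∉ M.closure (B : Set α))).image
    (fun y => insert y B)) with hJ
  have hJ_sub : J ⊆ Shadow.levelSet M (q + 1) := by
    rw [hJ, Finset.biUnion_subset]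
    intro B hB
    rw [Finset.image_subset_iff]
    intro y hy
    exact insert_mem_levelSet_of_out (hRbmem B hB).1 hy
  have hJcard : J.card = ∑ B ∈ Rb, ((gr M).filter (fun x => x ∉ M.closure (B : Set α))).card := by
    rw [hJ, Finset.card_biUnion]
    · apply Finset.sum_congr rfl
      intro B hB
      apply Finset.card_image_of_injOn
      intro y hy y' hy' hyy'
      have hyB : y ∉ B := notMem_of_mem_out (Profile.mem_Rq.1 (hRbmem B hB).1).1 (Finset.mem_coe.1 hy)
      simp only at hyy'
      have hmem : y ∈ insert y' B := hyy' ▸ Finset.mem_insert_self y B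
      rcases Finset.mem_insert.1 hmem with h | h
      · exact h
      · exact absurd h hyB
    · intro B hB B' hB' hne
      rw [Function.onFun, Finset.disjoint_left]
      intro S hS hS'
      rw [Finset.mem_image] at hS hS'
      obtain ⟨y, hy, rfl⟩ := hS
      obtain ⟨y', hy', heq⟩ := hS'
      obtain ⟨hBq, hBc⟩ := hRbmem B hB
      obtain ⟨hB'q, hB'c⟩ := hRbmem B' hB'
      exact insert_ne_insert_of_ne hg hB'q hBq hB'c hBc (Ne.symm hne) hy' hy heq
  have hdisj : Disjoint I J := by
    rw [Finset.disjoint_left]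
    intro S hSI hSJ
    rw [hI, Finset.mem_filter, Finset.mem_powersetCard] at hSI
    rw [hJ, Finset.mem_biUnion] at hSJ
    obtain ⟨B, hB, hSB⟩ := hSJ
    rw [Finset.mem_image] at hSB
    obtain ⟨y, hy, rfl⟩ := hSB
    obtain ⟨hBq, hBc⟩ := hRbmem B hB
    have hyB : y ∉ B := notMem_of_mem_out (Profile.mem_Rq.1 hBq).1 hy
    have := Finset.card_insert_of_notMem hyB
    omega
  have hlevel : I.card + J.card ≤ (Shadow.levelSet M (q + 1)).card := by
    rw [← Finset.card_union_of_disjoint hdisj]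
    exact Finset.card_le_card (Finset.union_subset hI_sub hJ_sub)
  have hc : ∑ B ∈ Rb, (if B.card = q + 1 then (1 : ℚ) else 0) = (D.card : ℚ) := by
    rw [Finset.sum_boole, hDRb1, hRb1]
  have hbsum : ∑ B ∈ Rb, ((((gr M).filter (fun x => x ∉ M.closure (B : Set α))).card : ℚ) -
      (if B.card = q + 1 then (1 : ℚ) else 0)) = (J.card : ℚ) - (D.card : ℚ) := by
    rw [Finset.sum_sub_distrib, hc, hJcard]
    push_cast
    rfl
  have hbsplit : ∑ B ∈ Rb, ((((gr M).filter (fun x => x ∉ M.closure (B : Set α))).card : ℚ) -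
        (if B.card = q + 1 then (1 : ℚ) else 0) +
        ((if B.card = q + 1 ∧ ((gr M).filter (fun x => x ∉ M.closure (B : Set α))).card = 2 ∧
            2 * q + 1 ≤ ((gr M).filter (fun x => x ∈ M.closure (B : Set α))).card then (1 : ℚ) / ((q : ℚ) + 1)
          else 0) +
        (if B.card = q + 2 ∧ ((gr M).filter (fun x => x ∉ M.closure (B : Set α))).card = 2 ∧
            2 * q + 1 ≤ ((gr M).filter (fun x => x ∈ M.closure (B : Set α))).card then -(q : ℚ) / ((q : ℚ) + 1)
          else 0))) =
      ∑ B ∈ Rb, ((((gr M).filter (fun x => x ∉ M.closure (B : Set α))).card : ℚ) -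
        (if B.card = q + 1 then (1 : ℚ) else 0)) +
      ∑ B ∈ Rb, ((if B.card = q + 1 ∧ ((gr M).filter (fun x => x ∉ M.closure (B : Set α))).card = 2 ∧
            2 * q + 1 ≤ ((gr M).filter (fun x => x ∈ M.closure (B : Set α))).card then (1 : ℚ) / ((q : ℚ) + 1)
          else 0) +
        (if B.card = q + 2 ∧ ((gr M).filter (fun x => x ∉ M.closure (B : Set α))).card = 2 ∧
            2 * q + 1 ≤ ((gr M).filter (fun x => x ∈ M.closure (B : Set α))).card then -(q : ℚ) / ((q : ℚ) + 1)
          else 0)) := Finset.sum_add_distrib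
  have hI' : (I.card : ℚ) = (Nat.choose n (q + 1) : ℚ) - (D.card : ℚ) := by
    have : (I.card : ℚ) + (D.card : ℚ) = (Nat.choose n (q + 1) : ℚ) := by exact_mod_cast hID
    linarith
  have hlevel' : (I.card : ℚ) + (J.card : ℚ) ≤ ((Shadow.levelSet M (q + 1)).card : ℚ) := by
    exact_mod_cast hlevel
  rw [hsplit]
  rw [hbsplit, hbsum] at hb
  linarith

/-- **C-025 AT `(q + 2, q)` AT GIRTH `≥ q + 1`**, `q ≥ 2`, every rank. -/
theorem rls_succ_succ_of_girth {q : ℕ} (hq : 2 ≤ q) (hg : ∀ T ⊆ M.E, T.encard ≤ q → M.Indep T) :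
    ThmN.RLS M (q + 2) q := by
  apply rls_of_profileIneq_rows
  intro u hqu hup
  have hu : u = q + 1 := by omega
  rw [hu]
  exact profileIneq_succ_of_girth hq hg

/-- **C-025 AT `(p, q)` FOR EVERY `p ≥ q + 2` ON EVERY MATROID OF GIRTH `≥ p − 1`**, `q ≥ 2`: every set with at most
`p − 2` points independent. -/
theorem rls_of_girth_all (p q : ℕ) (hq : 2 ≤ q) (hpq : q + 2 ≤ p)
    (hg : ∀ T ⊆ M.E, T.encard + 2 ≤ p → M.Indep T) : ThmN.RLS M p q := by
  rcases Nat.lt_or_ge (q + 2) p with hlt | hge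
  · exact rls_of_girth p q hlt hg
  · have hp : p = q + 2 := by omega
    subst hp
    apply rls_succ_succ_of_girth hq
    intro T hT hTc
    apply hg T hT
    have h2 : ((q : ℕ∞) + 2) = ((q + 2 : ℕ) : ℕ∞) := by norm_cast
    rw [← h2]
    exact add_le_add_left hTc 2

end GirthRows

end PercRepro
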